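import Summits.QuantumFields.BalabanUV.T4Continuum.Spine.NE1p.DressedSmallFieldCubeLetterWitness

/-!
# T⁴ programme, spine estimate NE1′ (node O3b/H2) — THE MIXED CUBE LETTER, part 1 (the `n`-cube dictionary): for a JOINTLY analytic
# table-free factor of ALL the `σ(Δ)` — no product structure — the iterated ONE-variable Cauchy letters of the NE5 substrate reproduce the
# MIXED decoupling difference `Δ_S F` over the active cubes `S`, and cost `B·Π_{Δ∈S} r_Δ∕(r_Δ−1)² ≤ B·e^{−(κ₁−1)·#S}` — print's first
# factor of (2.15) PER CUBE, whatever the joint dependence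

Cell `pub-balaban`, sub-cell `t4`, row NE1′ formalisation crew (`t4/formal/NE1p/LEAVES.md` row W39 part 1 = W39.1 ∕ DAG N29zv; own-initiative witness under
typer R-T61 (ii), INTENT journal l.17565, BOOKED R-T115 (iii) l.17757 — TWO PARTS, part 2 = W39.2 `DressedSmallFieldMixedLetterWitness`; X-read X137), unit
`b2b-balaban-t4-ne1p-formalise-leaf-08` (gen 10).  ADDITIVE — imports W34
`Spine/NE1p/DressedSmallFieldCubeLetterWitness` ONLY (leaf-08 g9, p225881: `one_lt_rexp`, `decouplingFactor_pow_le` BY NAME; through it the NE5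
substrate `Support/B13TermContours` — `lam₁`, `w₁`, `wB₁`, `circ`, `lamJ`, `wJ`, `sigmaJ`, `integral_w₁_mul_eq_sub` BY NAME — and W29's
`majorant_C_le`); dictionary DATA `def`s + theorems; 0 `def … : Prop`, 0 cite, 0 sorry; nothing of the substrate ∕ W29 ∕ W34 restated.

WHY THIS FILE.  W34 exercised [Balaban1988RGII] (2.15)'s mechanism — analytic & bounded on the big `σ(Δ)`-circle ⇒ decay `e^{−(κ₁−1)}` per cube —
for table-free factors that are PRODUCTS of one-variable cube factors (`G : Fin 2 → ℂ → ℂ`, W34 `cf`∕`preK`; its `hrep_K`∕`hL3_K` factorise cube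
by cube).  Print's integrand is not a product: (2.8) p. 14 applies «Π_{Δ⊂Z∖Z̃′₀} ∫₀¹ ds(Δ) ∂∕∂s(Δ)» to ONE expression which is «an analytic
function of s(Y₀), B, for |s(Y₀)| ≤ e^{κ₁}» (p. 6, last paragraph) JOINTLY in all the decoupling parameters, all derivatives being taken «by the
Cauchy formula … over the circles |σ(Δ)| = e^{κ₁}» (p. 7 (1.23), p. 15 (2.14)) with the bound «exp(−(κ₁ − 1)M⁻⁴|Y₀∖□̃⁴|)» (p. 7 (1.24); p. 15
(2.15)) — LOCI of the audited manuscript, TYPE∕CONTEXT only.  The substrate has the `n`-variable contour SPACE (`lamJ`, `wJ`, `sigmaJ`) but only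
the ONE-variable dictionary.  Here the `n`-variable dictionary is kernel-checked:
* §1 THE MIXED DECOUPLING DIFFERENCE `mixedDiff n S F` over an active set `S : Finset (Fin n)` of cubes (one first-order difference
  `σ(Δ) : 0 → 1` per active cube, inactive variables frozen at the decoupled value `0`; defined along `Fin.cons`), its two-cube faces
  (`mixedDiff_pair : Δ_{0,1}F = F(1,1) − F(1,0) − (F(0,1) − F(0,0))`, `mixedDiff_zero`, `mixedDiff_one`), analyticity in a spectator variable
  (`differentiable_mixedDiff`), linearity, and **`mixedDiff_prod`: on a PRODUCT of cube factors `Δ_S` is W34's `Π_{j∈S}(G j 1 − G j 0)`** —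
  W34 is the product case.
* §2 THE `n`-CUBE LETTER: coordinate measures `μS S` (`lam₁` on an active cube, a Dirac filler else; W34's `μc Z = μS (cubes₂ Z)` by `rfl`),
  weight `wS r S p = Π_{j∈S} w₁ (r j) (p j)`, contour configuration `σS r S p` (on the circle of radius `r j` for `j ∈ S`, `0` else);
  **`mixedLetter_rep`: for radii `> 1` and `F : (Fin n → ℂ) → ℂ` JOINTLY ℂ-differentiable, `∫ wS·F∘σS d(⨂ μS S) = Δ_S F`** — induction along
  `Fin.cons` (Mathlib `measurePreserving_piFinSuccAbove`, Fubini), the substrate's `integral_w₁_mul_eq_sub` BY NAME on the entire section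
  `σ(Δ₀) ↦ Δ_{S′}F(σ(Δ₀) ∷ ·)`, `integral_dirac` on an inactive cube — NO multi-variable Cauchy theory; **`mixedLetter_majorant_le`:
  `‖F∘σS‖ ≤ B ⇒ ∫‖wS·F∘σS‖ ≤ (Π_{j∈S} r_j∕(r_j−1)²)·B`**; **`mixedLetter_decay_le`: at radii `e^{κ₁}`, `κ₁ ≥ 1`, `≤ e^{−(κ₁−1)·#S}·B`**;
  `norm_σS_le` (the configuration lies in the closed polydisc); at `S = univ` the objects ARE the substrate's (`pi_μS_univ`, `wS_univ`,
  `σS_univ`) and **`mixedLetter_rep_univ : ∫ wJ r p·F(sigmaJ r p) dlamJ = Δ_univ F`** — the substrate's `n`-variable space gets its dictionary.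

HONEST FRAMING.  TYPER RIDER (R-T115 (iii)(g), verbatim): «`mixedDiff` ∕ `μS` ∕ `wS` ∕ `σS` are OUR dictionary on the substrate's (row NE5) contour SPACE, EQUAL to `lamJ` ∕ `wJ` ∕
`sigmaJ` at `S = univ` BY THEOREM; the polydisc bound `hB` is the toy's HYPOTHESIS carrying print's (1.18)∕(1.21) TYPE — not a bound proved for Bałaban's
operators; `Fj` is OUR decided non-product factor; κ₁ ≥ 1 ∕ κ₁ ≥ 6 are OUR thresholds on OUR majorants and W23's numerals — no numeral of [Balaban1988RGII];
(B1)∕(B3) for (2.14) NOT discharged».  [folklore] analysis (Fubini on `Measure.pi` along `Fin.cons`, Cauchy's formula through the substrate's checked ONE-variable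
dictionary, compactness of the closed polydisc) + located real arithmetic, on the substrate's CONTOUR OBJECTS; a DICTIONARY for (2.8)∕(2.14)'s cube
letters, not an estimate of print: the identification of `F` with print's s(Δ)-dependent operator products ((1.10)∕(2.7), `H_k(s(Y₀),B′)`, the
characteristic functions) and of the radii with (1.22)'s circle is a TYPE READING; the bound `‖F∘σS‖ ≤ B` is a HYPOTHESIS (print's (1.18)∕(1.21)
TYPE); the threshold `κ₁ ≥ 1` is OUR arithmetic on OUR majorant shape (W34 `decouplingFactor_le`) — no numeral of print asserted (k2); (B1) for
Bałaban's (2.14) NOT discharged; (B3) = GAPS G-ne9p2-5 UNPRINTED — NOT discharged, untouched; (B5) untouched; 0 binders instantiated on Bałaban's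
densities ∕ operators ∕ (2.14) data ∕ `d_k` ∕ minimisers ∕ backgrounds; discharges no wall item; wall v1.7 (T4-DAG v42) does NOT move; R-t4r2-Q2 NOT met
thereby; NE1′ ⇐ the named binders — NOT proved, NOT printed; spine PROVED 0∕9; count 9 unchanged.  Rung (B)+1 on ONE finite four-torus — NOT
infinite volume, NOT a mass gap, NOT OS on ℝ⁴, NOT Clay.  ABSOLUTE RULE honoured: the quotations are LOCI of the audited manuscript [Balaban1988RGII]
(CMP 116 (1988) 1–22, pp. 6, 7, 14, 15), TYPE∕CONTEXT only, never hypothesis-free facts; nothing internally minted is cited; [folklore]∕[arith] tags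
on kernel lemmas only.  HONEST DEPENDENCY: continuum YM on T⁴ ⇐ BetaPertH ∧ nine spine estimates (0/9 proved); BetaPertH ⇐ (D1) ∧ (D4) ∧
CAP+tail; G-an2-4 gates asym, D1 and NE2/3/4.
-/

noncomputable section

namespace Summit.QuantumFields.BalabanUV.T4Continuum.NE1p.DressedSmallFieldMixedLetter

open MeasureTheory Metric Set Complex Finset
open scoped BigOperators Function
open Summit.QuantumFields.BalabanUV.T4Continuum.B13TermContours
open Summit.QuantumFields.BalabanUV.T4Continuum.NE1p.DressedSmallFieldContourWitness (hint_C majorant_C_le)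
open Summit.QuantumFields.BalabanUV.T4Continuum.NE1p.DressedSmallFieldCubeLetterWitness (one_lt_rexp decouplingFactor_pow_le)

variable {n : ℕ}

/-! ## §1 THE MIXED DECOUPLING DIFFERENCE over a set `S` of active cubes (inactive variables frozen at the decoupled value `0`) -/

/-- The active set seen from the tail of `Fin (n + 1)`: `j ∈ tailSet S ↔ j.succ ∈ S`. [folklore] -/
def tailSet (S : Finset (Fin (n + 1))) : Finset (Fin n) := Finset.univ.filter fun j => j.succ ∈ S

/-- [folklore] Membership in the tail set. -/
@[simp] theorem mem_tailSet {S : Finset (Fin (n + 1))} {j : Fin n} : j ∈ tailSet S ↔ j.succ ∈ S := by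
  simp [tailSet]

/-- THE MIXED DECOUPLING DIFFERENCE `Δ_S F` of a function of `n` cube variables over the active cubes `S`: one first-order difference
`σ(Δ): 0 → 1` per active cube, the inactive variables frozen at `0` — what (2.8)'s «Π_{Δ} ∫₀¹ ds(Δ) ∂∕∂s(Δ)» leaves after the
`s`-integrations (TYPE).  Defined along `Fin.cons`. -/
def mixedDiff : (n : ℕ) → Finset (Fin n) → ((Fin n → ℂ) → ℂ) → ℂ
  | 0, _, F => F fun i => i.elim0
  | n + 1, S, F =>
      if (0 : Fin (n + 1)) ∈ S then
        mixedDiff n (tailSet S) (fun z => F (Fin.cons (1 : ℂ) z : Fin (n + 1) → ℂ)) -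
          mixedDiff n (tailSet S) (fun z => F (Fin.cons (0 : ℂ) z : Fin (n + 1) → ℂ))
      else mixedDiff n (tailSet S) (fun z => F (Fin.cons (0 : ℂ) z : Fin (n + 1) → ℂ))

/-- [folklore] The two-cube faces of the catalogue: both cubes active — the genuinely MIXED second difference. -/
theorem mixedDiff_pair (F : (Fin 2 → ℂ) → ℂ) :
    mixedDiff 2 {0, 1} F = F ![1, 1] - F ![1, 0] - (F ![0, 1] - F ![0, 0]) := by
  simp [mixedDiff]
  rfl

/-- [folklore] Only cube `0` active. -/
theorem mixedDiff_zero (F : (Fin 2 → ℂ) → ℂ) : mixedDiff 2 {0} F = F ![1, 0] - F ![0, 0] := by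
  simp [mixedDiff]
  rfl

/-- [folklore] Only cube `1` active. -/
theorem mixedDiff_one (F : (Fin 2 → ℂ) → ℂ) : mixedDiff 2 {1} F = F ![0, 1] - F ![0, 0] := by
  simp [mixedDiff]
  rfl

/-- [folklore] `Δ_S` is analytic in a spectator variable: if every section `σ ↦ F σ z` is entire, so is `σ ↦ Δ_S (F σ)`. -/
theorem differentiable_mixedDiff : ∀ (n : ℕ) (S : Finset (Fin n)) {F : ℂ → (Fin n → ℂ) → ℂ},
    (∀ z, Differentiable ℂ fun σ => F σ z) → Differentiable ℂ fun σ => mixedDiff n S (F σ)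
  | 0, _, _, hF => by simpa [mixedDiff] using hF _
  | n + 1, S, F, hF => by
      by_cases h : (0 : Fin (n + 1)) ∈ S
      · simp only [mixedDiff, if_pos h]
        exact (differentiable_mixedDiff n _ (F := fun σ z => F σ (Fin.cons 1 z)) fun z => hF _).sub
          (differentiable_mixedDiff n _ (F := fun σ z => F σ (Fin.cons 0 z)) fun z => hF _)
      · simp only [mixedDiff, if_neg h]
        exact differentiable_mixedDiff n _ (F := fun σ z => F σ (Fin.cons 0 z)) fun z => hF _

/-! ## §2 THE `n`-CUBE LETTER: iterated one-variable Cauchy letters reproduce `Δ_S F` for a JOINTLY analytic `F`, and cost `B·Π_{j∈S} r_j∕(r_j−1)²` -/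

/-- Per-coordinate weight: the Cauchy weight at radius `r j` on an active cube, `1` on an inactive one. -/
def cw (r : Fin n → ℝ) (S : Finset (Fin n)) (j : Fin n) (x : ℝ × ℝ) : ℂ := if j ∈ S then w₁ (r j) x else 1

/-- The product weight `Π_j cw_j (p j) = Π_{j∈S} w₁ (r j) (p j)` (substrate `wJ` with inactive cubes filled by `1`). -/
def wS (r : Fin n → ℝ) (S : Finset (Fin n)) (p : Fin n → ℝ × ℝ) : ℂ := ∏ j, cw r S j (p j)

/-- Per-coordinate contour value: `circ (r j) θ_j` on an active cube, the decoupled value `0` on an inactive one. -/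
def σc (r : Fin n → ℝ) (S : Finset (Fin n)) (j : Fin n) (x : ℝ × ℝ) : ℂ := if j ∈ S then circ (r j) x.2 else 0

/-- The contour configuration `σ_S(p) : Fin n → ℂ` fed to the joint factor. -/
def σS (r : Fin n → ℝ) (S : Finset (Fin n)) (p : Fin n → ℝ × ℝ) : Fin n → ℂ := fun j => σc r S j (p j)

/-- Per-coordinate parameter measure: `lam₁` on an active cube, a Dirac filler on an inactive one (W34's `μc` is the case
`S = cubes₂ Z`, by `rfl`). -/
def μS (S : Finset (Fin n)) (j : Fin n) : Measure (ℝ × ℝ) := if j ∈ S then lam₁ else Measure.dirac 0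

/-- [folklore] Every coordinate measure is finite. -/
instance isFiniteMeasure_μS (S : Finset (Fin n)) (j : Fin n) : IsFiniteMeasure (μS S j) := by
  unfold μS; split_ifs <;> infer_instance

/-- [folklore] Tail of the coordinate measures along `Fin.succ`. -/
theorem μS_succ (S : Finset (Fin (n + 1))) (j : Fin n) : μS S j.succ = μS (tailSet S) j := by
  simp only [μS, mem_tailSet]

/-- [folklore] Tail of the coordinate weights. -/
theorem cw_succ (r : Fin (n + 1) → ℝ) (S : Finset (Fin (n + 1))) (j : Fin n) :
    cw r S j.succ = cw (Fin.tail r) (tailSet S) j := by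
  funext x; simp only [cw, mem_tailSet, Fin.tail]

/-- [folklore] Tail of the contour values. -/
theorem σc_succ (r : Fin (n + 1) → ℝ) (S : Finset (Fin (n + 1))) (j : Fin n) :
    σc r S j.succ = σc (Fin.tail r) (tailSet S) j := by
  funext x; simp only [σc, mem_tailSet, Fin.tail]

/-- [folklore] The product weight along `Fin.cons`. -/
theorem wS_cons (r : Fin (n + 1) → ℝ) (S : Finset (Fin (n + 1))) (x : ℝ × ℝ) (z : Fin n → ℝ × ℝ) :
    wS r S (Fin.cons x z) = cw r S 0 x * wS (Fin.tail r) (tailSet S) z := by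
  simp only [wS, Fin.prod_univ_succ, Fin.cons_zero, Fin.cons_succ, cw_succ]

/-- [folklore] The contour configuration along `Fin.cons`. -/
theorem σS_cons (r : Fin (n + 1) → ℝ) (S : Finset (Fin (n + 1))) (x : ℝ × ℝ) (z : Fin n → ℝ × ℝ) :
    σS r S (Fin.cons x z) = Fin.cons (σc r S 0 x) (σS (Fin.tail r) (tailSet S) z) := by
  funext j
  induction j using Fin.cases with
  | zero => simp only [σS, Fin.cons_zero]
  | succ i => simp only [σS, Fin.cons_succ, σc_succ]

/-- [folklore] Each coordinate weight is measurable. -/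
theorem measurable_cw (r : Fin n → ℝ) (S : Finset (Fin n)) (j : Fin n) : Measurable (cw r S j) := by
  unfold cw; split_ifs; exacts [measurable_w₁ _, measurable_const]

/-- [folklore] The product weight is measurable. -/
theorem measurable_wS (r : Fin n → ℝ) (S : Finset (Fin n)) : Measurable (wS r S) :=
  Finset.measurable_prod _ fun j _ => (measurable_cw r S j).comp (measurable_pi_apply j)

/-- [folklore] Each contour value is measurable. -/
theorem measurable_σc (r : Fin n → ℝ) (S : Finset (Fin n)) (j : Fin n) : Measurable (σc r S j) := by
  unfold σc; split_ifs; exacts [(measurable_circ _).comp measurable_snd, measurable_const]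

/-- [folklore] The contour configuration is measurable. -/
theorem measurable_σS (r : Fin n → ℝ) (S : Finset (Fin n)) : Measurable (σS r S) :=
  measurable_pi_lambda _ fun j => (measurable_σc r S j).comp (measurable_pi_apply j)

/-- [folklore] The contour configuration lies in the CLOSED POLYDISC of radii `r`: `‖σ_S(p) j‖ ≤ r j` (`= r j` on an active cube, `0` else). -/
theorem norm_σS_le {r : Fin n → ℝ} (hr : ∀ j, 0 ≤ r j) (S : Finset (Fin n)) (p : Fin n → ℝ × ℝ) (j : Fin n) :
    ‖σS r S p j‖ ≤ r j := by
  simp only [σS, σc]; split_ifs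
  · exact (norm_circ (hr j) _).le
  · simpa using hr j

/-- [folklore] Size of a coordinate weight for radii `> 1`: `≤ max (wB₁ (r j)) 1`. -/
theorem norm_cw_le {r : Fin n → ℝ} (hr : ∀ j, 1 < r j) (S : Finset (Fin n)) (j : Fin n) (x : ℝ × ℝ) :
    ‖cw r S j x‖ ≤ max (wB₁ (r j)) 1 := by
  unfold cw; split_ifs; exacts [(norm_w₁_le (hr j) x).trans (le_max_left _ _), by simp]

/-- [folklore] Size of the product weight. -/
theorem norm_wS_le {r : Fin n → ℝ} (hr : ∀ j, 1 < r j) (S : Finset (Fin n)) (p : Fin n → ℝ × ℝ) :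
    ‖wS r S p‖ ≤ ∏ j, max (wB₁ (r j)) 1 := by
  rw [wS, norm_prod]
  exact Finset.prod_le_prod (fun _ _ => norm_nonneg _) fun j _ => norm_cw_le hr S j _

/-- [folklore] `σ ↦ σ ∷ z` is entire (affine). -/
theorem differentiable_cons_left (z : Fin n → ℂ) : Differentiable ℂ fun σ : ℂ => (Fin.cons σ z : Fin (n + 1) → ℂ) :=
  differentiable_pi.2 fun i => by
    induction i using Fin.cases with
    | zero => simp
    | succ j => simp

/-- [folklore] `z ↦ c ∷ z` is entire (affine). -/
theorem differentiable_cons_right (c : ℂ) : Differentiable ℂ fun z : Fin n → ℂ => (Fin.cons c z : Fin (n + 1) → ℂ) :=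
  differentiable_pi.2 fun i => by
    induction i using Fin.cases with
    | zero => simp
    | succ j => simpa using differentiable_apply (𝕜 := ℂ) j

/-- **THE `n`-CUBE LETTER REPRODUCES THE MIXED DECOUPLING DIFFERENCE** (kernel; induction along `Fin.cons`: Mathlib's
`measurePreserving_piFinSuccAbove` + Fubini, the substrate's ONE-variable dictionary `integral_w₁_mul_eq_sub` BY NAME on the entire section
`σ(Δ₀) ↦ Δ_{S′} F(σ(Δ₀) ∷ ·)`, a Dirac filler on an inactive cube): for radii `r j > 1` and `F : (Fin n → ℂ) → ℂ` JOINTLY complex-differentiable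
— NOT assumed to be a product over the cubes — `∫ (Π_{j∈S} w₁ (r j) (p j))·F(σ_S(p)) d(⨂_j μS S j)(p) = Δ_S F`.  Print's (2.8)∕(2.14)∕(1.23): all the
`∂∕∂s(Δ)` of ONE analytic expression by Cauchy over the circles `|σ(Δ)| = r` — TYPE; no multi-variable Cauchy theory is needed, only Fubini and the
one-variable letter, because `Δ_S` of an analytic function is again analytic in each remaining variable. -/
theorem mixedLetter_rep : ∀ (n : ℕ) (r : Fin n → ℝ) (S : Finset (Fin n)) (F : (Fin n → ℂ) → ℂ),
    (∀ j, 1 < r j) → Differentiable ℂ F → ∫ p, wS r S p * F (σS r S p) ∂(Measure.pi (μS S)) = mixedDiff n S F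
  | 0, r, S, F, _, _ => by
      rw [Measure.pi_of_empty (μS S), integral_dirac]
      have h0 : ∀ p : Fin 0 → ℝ × ℝ, σS r S p = fun i => i.elim0 := fun p => funext fun i => i.elim0
      simp [wS, h0, mixedDiff]
  | n + 1, r, S, F, hr, hF => by
      have hr' : ∀ j, 1 < Fin.tail r j := fun j => hr j.succ
      have hr0 : ∀ j, 0 ≤ r j := fun j => zero_le_one.trans (hr j).le
      set G : (Fin (n + 1) → ℝ × ℝ) → ℂ := fun p => wS r S p * F (σS r S p) with hG
      -- (i) `G` is measurable and bounded (the contour configuration stays in a compact polydisc), hence integrable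
      have hGm : Measurable G := (measurable_wS r S).mul (hF.continuous.measurable.comp (measurable_σS r S))
      obtain ⟨B, hB⟩ : ∃ B, ∀ p, ‖F (σS r S p)‖ ≤ B := by
        obtain ⟨B, hB⟩ := (isCompact_closedBall (0 : Fin (n + 1) → ℂ) (∑ j, r j)).exists_bound_of_continuousOn
          hF.continuous.continuousOn
        refine ⟨B, fun p => hB _ (mem_closedBall_zero_iff.2 ((pi_norm_le_iff_of_nonneg
          (Finset.sum_nonneg fun j _ => hr0 j)).2 fun j => (norm_σS_le hr0 S p j).trans
            (Finset.single_le_sum (fun j _ => hr0 j) (Finset.mem_univ j))))⟩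
      have hGb : ∀ p, ‖G p‖ ≤ (∏ j, max (wB₁ (r j)) 1) * B := fun p => by
        rw [hG]; dsimp only; rw [norm_mul]
        exact mul_le_mul (norm_wS_le hr S p) (hB p) (norm_nonneg _)
          (Finset.prod_nonneg fun _ _ => zero_le_one.trans (le_max_right _ _))
      have hGi : Integrable G (Measure.pi (μS S)) :=
        Integrable.mono' (integrable_const _) hGm.aestronglyMeasurable (Filter.Eventually.of_forall hGb)
      -- (ii) Fubini along `Fin.cons`: the coordinate `0` against the tail
      have hmp := (measurePreserving_piFinSuccAbove (μS S) 0).symm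
      have hpi : (fun j : Fin n => μS S (Fin.succAbove 0 j)) = μS (tailSet S) := by
        funext j; rw [Fin.succAbove_zero]; exact μS_succ S j
      rw [hpi] at hmp
      have he : ∀ q : (ℝ × ℝ) × (Fin n → ℝ × ℝ),
          (MeasurableEquiv.piFinSuccAbove (fun _ : Fin (n + 1) => ℝ × ℝ) 0).symm q = Fin.cons q.1 q.2 := by
        intro q
        simp only [MeasurableEquiv.piFinSuccAbove_symm_apply, Fin.insertNthEquiv, Fin.insertNth_zero, Equiv.coe_fn_mk]
        rfl
      have h1 : ∫ p, G p ∂(Measure.pi (μS S)) = ∫ q, G (Fin.cons q.1 q.2) ∂((μS S 0).prod (Measure.pi (μS (tailSet S)))) := by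
        rw [← hmp.integral_comp']
        exact integral_congr_ae (Filter.Eventually.of_forall fun q => by dsimp only; rw [he])
      have hint : Integrable (fun q : (ℝ × ℝ) × (Fin n → ℝ × ℝ) => G (Fin.cons q.1 q.2))
          ((μS S 0).prod (Measure.pi (μS (tailSet S)))) :=
        ((hmp.integrable_comp hGi.aestronglyMeasurable).2 hGi).congr
          (Filter.Eventually.of_forall fun q => by simp only [Function.comp_apply, he])
      have hcons : ∀ (x : ℝ × ℝ) (z : Fin n → ℝ × ℝ), G (Fin.cons x z) =
          cw r S 0 x * (wS (Fin.tail r) (tailSet S) z * F (Fin.cons (σc r S 0 x) (σS (Fin.tail r) (tailSet S) z))) := fun x z => by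
        rw [hG]; dsimp only; rw [wS_cons, σS_cons]; ring
      -- (iii) the inner integral is the induction hypothesis on the section `σ(Δ₀) = σc r S 0 x`
      have hinner : ∀ x : ℝ × ℝ, ∫ z, G (Fin.cons x z) ∂(Measure.pi (μS (tailSet S))) =
          cw r S 0 x * mixedDiff n (tailSet S) (fun z => F (Fin.cons (σc r S 0 x) z)) := fun x => by
        simp_rw [hcons]
        rw [integral_const_mul, mixedLetter_rep n (Fin.tail r) (tailSet S) (fun z => F (Fin.cons (σc r S 0 x) z)) hr'
          (hF.comp (differentiable_cons_right _))]
      rw [h1, integral_prod _ hint]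
      dsimp only
      simp_rw [hinner]
      -- (iv) the outer integral: the one-variable letter on an active cube, the Dirac filler on an inactive one
      by_cases h0 : (0 : Fin (n + 1)) ∈ S
      · have hμ0 : μS S 0 = lam₁ := if_pos h0
        have hcw : ∀ x, cw r S 0 x = w₁ (r 0) x := fun x => if_pos h0
        have hσ : ∀ x : ℝ × ℝ, σc r S 0 x = circ (r 0) x.2 := fun x => if_pos h0
        have hH : Differentiable ℂ fun σ : ℂ => mixedDiff n (tailSet S) (fun z => F (Fin.cons σ z)) :=
          differentiable_mixedDiff n (tailSet S) (F := fun σ z => F (Fin.cons σ z)) fun z => hF.comp (differentiable_cons_left z)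
        have key := integral_w₁_mul_eq_sub (hr 0) isOpen_univ (Set.subset_univ _)
          (F := fun σ => mixedDiff n (tailSet S) (fun z => F (Fin.cons σ z))) hH.differentiableOn
        simp_rw [hμ0, hcw, hσ]
        rw [key]
        simp only [mixedDiff, if_pos h0]
      · have hμ0 : μS S 0 = Measure.dirac 0 := if_neg h0
        have hcw : ∀ x, cw r S 0 x = 1 := fun x => if_neg h0
        have hσ : ∀ x : ℝ × ℝ, σc r S 0 x = 0 := fun x => if_neg h0
        simp_rw [hμ0, hcw, hσ, one_mul]
        rw [integral_dirac]
        simp only [mixedDiff, if_neg h0]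

/-- **THE `n`-CUBE LETTER'S (2.15)-MAJORANT** (kernel; Fubini `integral_fintype_prod_eq_prod`, W29 `majorant_C_le` per active cube): if the joint
factor is bounded by `B` on the contour configurations, `∫ ‖(Π_{j∈S} w₁ (r j) (p j))·F(σ_S(p))‖ ≤ (Π_{j∈S} r_j∕(r_j − 1)²)·B` — one factor
`r∕(r−1)²` PER ACTIVE CUBE, whatever the dependence of `F` on the cubes jointly. -/
theorem mixedLetter_majorant_le {r : Fin n → ℝ} (hr : ∀ j, 1 < r j) (S : Finset (Fin n)) {F : (Fin n → ℂ) → ℂ} {B : ℝ}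
    (hB : ∀ p, ‖F (σS r S p)‖ ≤ B) :
    ∫ p, ‖wS r S p * F (σS r S p)‖ ∂(Measure.pi (μS S)) ≤ (∏ j ∈ S, r j / (r j - 1) ^ 2) * B := by
  have hB0 : 0 ≤ B := (norm_nonneg _).trans (hB fun _ => (0, 0))
  have hm : ∀ j, Measurable fun x => ‖cw r S j x‖ := fun j => (measurable_cw r S j).norm
  have hbd : ∀ p : Fin n → ℝ × ℝ, (∏ j, ‖cw r S j (p j)‖) * B ≤ (∏ j, max (wB₁ (r j)) 1) * B := fun p =>
    mul_le_mul_of_nonneg_right (Finset.prod_le_prod (fun _ _ => norm_nonneg _) fun j _ => norm_cw_le hr S j _) hB0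
  have hi : Integrable (fun p : Fin n → ℝ × ℝ => (∏ j, ‖cw r S j (p j)‖) * B) (Measure.pi (μS S)) :=
    Integrable.mono' (integrable_const ((∏ j, max (wB₁ (r j)) 1) * B))
      ((Finset.measurable_prod _ fun j _ => (hm j).comp (measurable_pi_apply j)).mul_const B).aestronglyMeasurable
      (Filter.Eventually.of_forall fun p => by
        rw [Real.norm_of_nonneg (mul_nonneg (Finset.prod_nonneg fun _ _ => norm_nonneg _) hB0)]; exact hbd p)
  calc ∫ p, ‖wS r S p * F (σS r S p)‖ ∂(Measure.pi (μS S))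
      ≤ ∫ p, (∏ j, ‖cw r S j (p j)‖) * B ∂(Measure.pi (μS S)) :=
        integral_mono_of_nonneg (Filter.Eventually.of_forall fun _ => norm_nonneg _) hi
          (Filter.Eventually.of_forall fun p => by
            dsimp only
            rw [norm_mul, wS, norm_prod]
            exact mul_le_mul_of_nonneg_left (hB p) (Finset.prod_nonneg fun _ _ => norm_nonneg _))
    _ = (∏ j, ∫ x, ‖cw r S j x‖ ∂(μS S j)) * B := by
        rw [integral_mul_const, integral_fintype_prod_eq_prod (𝕜 := ℝ) (fun j x => ‖cw r S j x‖)]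
    _ ≤ (∏ j ∈ S, r j / (r j - 1) ^ 2) * B := by
        refine mul_le_mul_of_nonneg_right ?_ hB0
        have hcube : ∀ j, ∫ x, ‖cw r S j x‖ ∂(μS S j) ≤ if j ∈ S then r j / (r j - 1) ^ 2 else 1 := by
          intro j; unfold cw μS; split_ifs with h
          · simpa using majorant_C_le (hr j) 0
          · simp
        calc ∏ j, ∫ x, ‖cw r S j x‖ ∂(μS S j) ≤ ∏ j, (if j ∈ S then r j / (r j - 1) ^ 2 else 1) :=
              Finset.prod_le_prod (fun j _ => integral_nonneg fun _ => norm_nonneg _) fun j _ => hcube j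
          _ = ∏ j ∈ S, r j / (r j - 1) ^ 2 := by rw [Finset.prod_ite_mem, Finset.univ_inter]

/-- **… AT THE (1.22)-RADIUS `e^{κ₁}`: DECAY `e^{−(κ₁−1)}` PER ACTIVE CUBE** (W34 `decouplingFactor_pow_le` BY NAME): for `1 ≤ κ₁`,
`∫ ‖(Π_{j∈S} w₁ (e^{κ₁}) (p j))·F(σ_S(p))‖ ≤ e^{−(κ₁ − 1)·#S}·B` — print's first factor of (2.15), «exp(−(κ₁ − 1)·#cubes)», for a JOINT factor. -/
theorem mixedLetter_decay_le {κ₁ : ℝ} (hκ : 1 ≤ κ₁) (S : Finset (Fin n)) {F : (Fin n → ℂ) → ℂ} {B : ℝ}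
    (hB : ∀ p, ‖F (σS (fun _ => Real.exp κ₁) S p)‖ ≤ B) :
    ∫ p, ‖wS (fun _ => Real.exp κ₁) S p * F (σS (fun _ => Real.exp κ₁) S p)‖ ∂(Measure.pi (μS S)) ≤
      Real.exp (-((κ₁ - 1) * S.card)) * B := by
  have hB0 : 0 ≤ B := (norm_nonneg _).trans (hB fun _ => (0, 0))
  refine (mixedLetter_majorant_le (fun _ => one_lt_rexp (by linarith)) S hB).trans ?_
  rw [Finset.prod_const]
  exact mul_le_mul_of_nonneg_right (decouplingFactor_pow_le hκ _) hB0

/-- [folklore] With every cube active the coordinate measures are the substrate's product contour measure `lamJ`. -/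
theorem pi_μS_univ (n : ℕ) : Measure.pi (μS (Finset.univ : Finset (Fin n))) = lamJ (Fin n) := by
  unfold lamJ; congr 1; funext j; simp [μS]

/-- [folklore] … the weight is the substrate's `wJ`. -/
theorem wS_univ (r : Fin n → ℝ) : wS r Finset.univ = wJ r := by
  funext p; simp [wS, cw, wJ]

/-- [folklore] … and the contour configuration is the substrate's `sigmaJ`. -/
theorem σS_univ (r : Fin n → ℝ) : σS r Finset.univ = sigmaJ r := by
  funext p j; simp [σS, σc, sigmaJ]

/-- **THE SUBSTRATE's `n`-VARIABLE CONTOUR SPACE GETS ITS DICTIONARY** (§2 at `S = univ`): for radii `> 1` and a JOINTLY entire `F`,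
`∫ wJ r p · F(sigmaJ r p) dlamJ(p) = Δ_univ F` — `(lamJ, wJ, sigmaJ)` of `Support/B13TermContours` §2 encode the full mixed decoupling
difference of (2.8), not only letter-by-letter products. -/
theorem mixedLetter_rep_univ (r : Fin n → ℝ) (hr : ∀ j, 1 < r j) (F : (Fin n → ℂ) → ℂ) (hF : Differentiable ℂ F) :
    ∫ p, wJ r p * F (sigmaJ r p) ∂(lamJ (Fin n)) = mixedDiff n Finset.univ F := by
  rw [← pi_μS_univ, ← wS_univ, ← σS_univ]; exact mixedLetter_rep n r _ F hr hF

/-- [folklore] A product over an active set along `Fin.cons`. -/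
theorem prod_mem_succ (S : Finset (Fin (n + 1))) (f : Fin (n + 1) → ℂ) :
    ∏ j ∈ S, f j = (if (0 : Fin (n + 1)) ∈ S then f 0 else 1) * ∏ j ∈ tailSet S, f j.succ := by
  have h : ∀ {m : ℕ} (T : Finset (Fin m)) (g : Fin m → ℂ), ∏ j ∈ T, g j = ∏ j, if j ∈ T then g j else 1 :=
    fun T g => by rw [Finset.prod_ite_mem, Finset.univ_inter]
  rw [h S, Fin.prod_univ_succ, h (tailSet S)]
  simp only [mem_tailSet]

/-- [folklore] `Δ_S` is linear: constants pull out. -/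
theorem mixedDiff_const_mul : ∀ (n : ℕ) (S : Finset (Fin n)) (c : ℂ) (F : (Fin n → ℂ) → ℂ),
    mixedDiff n S (fun z => c * F z) = c * mixedDiff n S F
  | 0, _, _, _ => rfl
  | n + 1, S, c, F => by
      by_cases h : (0 : Fin (n + 1)) ∈ S
      · simp only [mixedDiff, if_pos h, mixedDiff_const_mul n]; ring
      · simp only [mixedDiff, if_neg h, mixedDiff_const_mul n]

/-- **W34 IS THE PRODUCT CASE** [folklore]: for a factor that IS a product of one-variable cube factors over the active cubes, the mixed
difference factorises into W34's per-cube differences `Π_{j∈S} (G j 1 − G j 0)` — §2's letter strictly extends W34's `hrep_K`. -/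
theorem mixedDiff_prod : ∀ (n : ℕ) (S : Finset (Fin n)) (G : Fin n → ℂ → ℂ),
    mixedDiff n S (fun z => ∏ j ∈ S, G j (z j)) = ∏ j ∈ S, (G j 1 - G j 0)
  | 0, S, G => by simp [mixedDiff, Finset.eq_empty_of_isEmpty S]
  | n + 1, S, G => by
      have hc : ∀ (c : ℂ) (z : Fin n → ℂ), ∏ j ∈ S, G j ((Fin.cons c z : Fin (n + 1) → ℂ) j) =
          (if (0 : Fin (n + 1)) ∈ S then G 0 c else 1) * ∏ j ∈ tailSet S, G j.succ (z j) := fun c z => by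
        rw [prod_mem_succ]; simp only [Fin.cons_zero, Fin.cons_succ]
      have ih := mixedDiff_prod n (tailSet S) (fun j => G j.succ)
      simp only [mixedDiff, hc, mixedDiff_const_mul, ih]
      rw [prod_mem_succ S (fun j => G j 1 - G j 0)]
      split_ifs <;> ring

end Summit.QuantumFields.BalabanUV.T4Continuum.NE1p.DressedSmallFieldMixedLetter

end
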